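import Mathlib
import Summits.Ventures.PercRepro2.SwOutCrossJunctionBaseThm

/-!
# A core-kind class point is a point of the block of its base (blind cell PercRepro2, night-4
g24, 2026-08-28; proofs/NIGHT4-G24.md §4)

At a core-kind `Q`-point `ζ` the dropped vertices lie on ONE side (`p_same_side`: each is on a
side, adjacent ones are on the same side, `G` is connected); on the red side every u–`p i` edge
is red and every outside edge of a `p i` blue, on the blue side the mirror.  The point `qOf ζ`
of the cube of the base `baseX ζ` — an arm red iff it lies in the red cluster of `h`, a dropped
vertex attached iff it lies in the red cluster of `u`, the outside bits the same, a cross edge red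
iff it is red at `ζ` — realises `ζ` (`crossReal_qOf`) and does not leak (`not_leakRX_qOf`,
`not_leakBX_qOf`); hence `ζ ∈ blockX (baseX ζ)` (`mem_blockX_baseX`).
-/

namespace Summit.Ventures.PercRepro2

namespace CrossArm

open Hull LocRows

variable {V : Type*} {E : Type*} [Fintype E] [DecidableEq E]

open scoped Classical

variable {ends : E → Sym2 V} {X : Type*} {U : Set V} {ξ : Config E} {l h o u : V} {p : X → V}
  {G : SimpleGraph X}

section PSide

variable (hj : CrossJunction ends U h u p G o) (hl : l ∉ U) {ζ : Config E}
  (hζ : ζ ∈ swOutSide ends l h o U ξ) (hk : CoreKind ends U h u ζ)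
include hj hl hζ hk

omit hl hζ hk in
omit [Fintype E] [DecidableEq E] in
/-- A dropped vertex lies on a side. -/
lemma CrossJunction.p_side (i : X) : p i ∈ redExt ends h u ζ ∨ p i ∈ blueExt ends ζ h u := by
  have hpH : p i ∈ extHull ends ζ h u := BigBlock.p_mem_extHull (hj.hup i) ζ
  rw [extHull_eq] at hpH
  rcases hpH with ((h' | h') | h') | h'
  · exact absurd h' (hj.hne_hp i).symm
  · exact absurd h' (hj.hne_up i).symm
  · exact Or.inl h'
  · exact Or.inr h'

/-- On the red side the u–`p i` edges are red. -/
lemma CrossJunction.up_red_of_redExt {i : X} (hi : p i ∈ redExt ends h u ζ) {e : E}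
    (he : ends e = s(u, p i)) : ζ e = true := by
  cases hc : ζ e with
  | true => rfl
  | false =>
    have hb : blue ζ e = true := by rw [blue_eq_true_iff]; exact hc
    exact absurd (mem_blueExt_iff.2 ⟨Or.inr (mem_cluster_of_edge (mem_cluster_self _ _ _) hb he),
      (hj.hne_hp i).symm, (hj.hne_up i).symm⟩) (hj.sides_disjoint hl hζ hk (p i) hi)

/-- On the blue side the u–`p i` edges are blue. -/
lemma CrossJunction.up_blue_of_blueExt {i : X} (hi : p i ∈ blueExt ends ζ h u) {e : E}
    (he : ends e = s(u, p i)) : ζ e = false := by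
  cases hc : ζ e with
  | false => rfl
  | true =>
    exact absurd (mem_redExt_iff.2 ⟨Or.inr (mem_cluster_of_edge (mem_cluster_self _ _ _) hc he),
      (hj.hne_hp i).symm, (hj.hne_up i).symm⟩) fun h' => hj.sides_disjoint hl hζ hk (p i) h' hi

/-- On the red side a dropped vertex is in the red cluster of `u`. -/
lemma CrossJunction.p_mem_cluster_u_of_redExt {i : X} (hi : p i ∈ redExt ends h u ζ) :
    p i ∈ cluster ends ζ u := by
  obtain ⟨e, he⟩ := hj.hup i
  exact mem_cluster_of_edge (mem_cluster_self _ _ _) (hj.up_red_of_redExt hl hζ hk hi he) he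

/-- On the blue side a dropped vertex is not in the red cluster of `u`. -/
lemma CrossJunction.p_notMem_cluster_u_of_blueExt {i : X} (hi : p i ∈ blueExt ends ζ h u) :
    p i ∉ cluster ends ζ u := fun h' =>
  hj.sides_disjoint hl hζ hk (p i)
    (mem_redExt_iff.2 ⟨Or.inr h', (hj.hne_hp i).symm, (hj.hne_up i).symm⟩) hi

omit hl in
/-- On the red side the outside edges of a dropped vertex are blue. -/
lemma CrossJunction.ext_blue_of_redExt {i : X} (hi : p i ∈ redExt ends h u ζ) {e : E} {x : V}
    (he : ends e = s(p i, x)) (hxu : x ≠ u) (hxp : ∀ j, x ≠ p j) : ζ e = false := by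
  rcases hj.p_nbr he with h' | ⟨j, h', -⟩ | hxU
  · exact absurd h' hxu
  · exact absurd h' (hxp j)
  · cases hc : ζ e with
    | false => rfl
    | true =>
      exfalso
      rw [mem_redExt_iff] at hi
      rcases hi.1 with hpi | hpi
      · exact hxU ((mem_outClass.1 (mem_swOutSide.1 hζ).2).2 (Or.inl (mem_cluster_of_edge hpi hc he)))
      · exact hxU (hk.2 (Or.inl (mem_cluster_of_edge hpi hc he)))

omit hl in
/-- On the blue side the outside edges of a dropped vertex are red. -/
lemma CrossJunction.ext_red_of_blueExt {i : X} (hi : p i ∈ blueExt ends ζ h u) {e : E} {x : V}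
    (he : ends e = s(p i, x)) (hxu : x ≠ u) (hxp : ∀ j, x ≠ p j) : ζ e = true := by
  rcases hj.p_nbr he with h' | ⟨j, h', -⟩ | hxU
  · exact absurd h' hxu
  · exact absurd h' (hxp j)
  · cases hc : ζ e with
    | true => rfl
    | false =>
      exfalso
      have hb : blue ζ e = true := by rw [blue_eq_true_iff]; exact hc
      rw [mem_blueExt_iff] at hi
      rcases hi.1 with hpi | hpi
      · exact hxU ((mem_outClass.1 (mem_swOutSide.1 hζ).2).2 (Or.inr (mem_cluster_of_edge hpi hb he)))
      · exact hxU (hk.2 (Or.inr (mem_cluster_of_edge hpi hb he)))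

/-- Adjacent dropped vertices lie on the same side. -/
lemma CrossJunction.redExt_of_adj {i j : X} (hij : G.Adj i j) (hi : p i ∈ redExt ends h u ζ) :
    p j ∈ redExt ends h u ζ := by
  rcases hj.p_side j with h' | h'
  · exact h'
  · obtain ⟨e, he⟩ := hj.hcross i j hij
    exact absurd he fun he =>
      no_edge_redExt_blueExt (hj.sides_disjoint hl hζ hk) he hi h'

/-- Along a walk of `G` the red side is kept. -/
lemma CrossJunction.redExt_of_walk : ∀ {a b : X}, G.Walk a b → p a ∈ redExt ends h u ζ →
    p b ∈ redExt ends h u ζ := by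
  intro a b w
  induction w with
  | nil => exact id
  | cons hadj _ ih => exact fun ha => ih (hj.redExt_of_adj hl hζ hk hadj ha)

/-- **The dropped vertices lie on one side.** -/
theorem CrossJunction.p_same_side (hG : G.Connected) :
    (∀ i, p i ∈ redExt ends h u ζ) ∨ ∀ i, p i ∈ blueExt ends ζ h u := by
  haveI := hG.nonempty
  let i₀ : X := Classical.arbitrary X
  rcases hj.p_side i₀ with h₀ | h₀
  · left
    intro j
    exact hj.redExt_of_walk hl hζ hk (hG.preconnected i₀ j).some h₀
  · right
    intro j
    rcases hj.p_side j with h' | h'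
    · exact absurd h₀ fun h₀ => hj.sides_disjoint hl hζ hk (p i₀)
        (hj.redExt_of_walk hl hζ hk (hG.preconnected j i₀).some h') h₀
    · exact h'

/-- The colour of the base on an edge touching an arm of the red side. -/
lemma CrossJunction.baseX_touch_red {P : Set V} (hP : P ∈ armsC ends h u ζ) (hPp : ∀ i, p i ∉ P)
    (hPr : P ⊆ rside ends ζ h) {e : E} (he : e ∈ touches ends P) : baseX ends h u p ζ e = ζ e := by
  obtain ⟨x, hx, y, hxy⟩ := he
  rcases arm_edge_cases hP hxy hx with hy | rfl | rfl | hy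
  · exact hj.baseX_inside_red hζ hk hP hPp hPr hxy hx hy
  · rw [hj.baseX_h_edge hl hζ hk (ends_swap hxy)]
    cases hc : ζ e with
    | true => rfl
    | false =>
      have hb : blue ζ e = true := by rw [blue_eq_true_iff]; exact hc
      exact absurd (mem_cluster_of_edge (mem_cluster_self _ _ _) hb (ends_swap hxy)) (hPr hx).2
  · rw [hj.baseX_u_edge hl hζ hk (ends_swap hxy)]
    cases hc : ζ e with
    | true => rfl
    | false =>
      have hb : blue ζ e = true := by rw [blue_eq_true_iff]; exact hc
      exact absurd (mem_blueExt_iff.2 ⟨Or.inr (mem_cluster_of_edge (mem_cluster_self _ _ _) hb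
        (ends_swap hxy)), (armsC_subset hP x hx).2.1, (armsC_subset hP x hx).2.2⟩)
        (hj.sides_disjoint hl hζ hk x (mem_redExt_iff.2 ⟨Or.inl (hPr hx).1,
          (armsC_subset hP x hx).2.1, (armsC_subset hP x hx).2.2⟩))
  · rw [hj.baseX_bdry hl hζ hk hP hPp hxy hx hy]
    cases hc : ζ e with
    | false => rfl
    | true =>
      exact absurd (show y ∈ extHull ends ζ h u from
        Or.inl (Or.inl (mem_cluster_of_edge (hPr hx).1 hc hxy))) hy

/-- The colour of the base on an edge touching an arm of the blue side. -/
lemma CrossJunction.baseX_touch_blue {P : Set V} (hP : P ∈ armsC ends h u ζ) (hPp : ∀ i, p i ∉ P)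
    (hPb : P ⊆ bside ends ζ h) {e : E} (he : e ∈ touches ends P) :
    baseX ends h u p ζ e = !ζ e := by
  obtain ⟨x, hx, y, hxy⟩ := he
  rcases arm_edge_cases hP hxy hx with hy | rfl | rfl | hy
  · exact hj.baseX_inside_blue hζ hk hP hPp hPb hxy hx
  · rw [hj.baseX_h_edge hl hζ hk (ends_swap hxy)]
    cases hc : ζ e with
    | false => rfl
    | true => exact absurd (mem_cluster_of_edge (mem_cluster_self _ _ _) hc (ends_swap hxy)) (hPb hx).2
  · rw [hj.baseX_u_edge hl hζ hk (ends_swap hxy)]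
    cases hc : ζ e with
    | false => rfl
    | true =>
      exact absurd (mem_blueExt_iff.2 ⟨Or.inl (hPb hx).1, (armsC_subset hP x hx).2.1,
        (armsC_subset hP x hx).2.2⟩) (hj.sides_disjoint hl hζ hk x (mem_redExt_iff.2
          ⟨Or.inr (mem_cluster_of_edge (mem_cluster_self _ _ _) hc (ends_swap hxy)),
            (armsC_subset hP x hx).2.1, (armsC_subset hP x hx).2.2⟩))
  · rw [hj.baseX_bdry hl hζ hk hP hPp hxy hx hy]
    cases hc : ζ e with
    | true => rfl
    | false =>
      have hb : blue ζ e = true := by rw [blue_eq_true_iff]; exact hc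
      exact absurd (show y ∈ extHull ends ζ h u from
        Or.inl (Or.inr (mem_cluster_of_edge (hPb hx).1 hb hxy))) hy


end PSide

section Real

variable [Fintype X] [DecidableRel G.Adj]

variable (ends) (h u) (p) (G)

/-- **The point of the cube of the base realising a core-kind point**: an arm red iff inside the
red cluster of `h`, a dropped vertex attached iff in the red cluster of `u`, the outside bits the
same, a cross edge red iff red at the point. -/
noncomputable def qOf (ζ : Config E) :
    PtXG (ιX ends h u p (baseX ends h u p ζ)) (κX ends h u p (baseX ends h u p ζ)) X G :=
  (fun k => decide (k.1 ⊆ cluster ends ζ h), fun j => decide (j.1 ⊆ cluster ends ζ h),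
    fun i => decide (p i ∈ cluster ends ζ u),
    fun s => decide (∃ e ∈ clsCX ends p G s, ζ e = true), fun i => decide (p i ∈ cluster ends ζ u))

variable {ends h u p G}

variable (hj : CrossJunction ends U h u p G o) (hl : l ∉ U) {ζ : Config E}
  (hζ : ζ ∈ swOutSide ends l h o U ξ) (hk : CoreKind ends U h u ζ)
include hj hl hζ hk

omit hj hl hζ hk in
omit [Fintype E] [DecidableEq E] [Fintype X] [DecidableRel G.Adj] in
/-- The base on a u–`p i` edge. -/
lemma baseX_UP {e : E} {i : X} (he : ends e = s(u, p i)) : baseX ends h u p ζ e = true :=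
  crossForce_UP he

omit hj hl hζ hk in
omit [Fintype E] [DecidableEq E] [Fintype X] [DecidableRel G.Adj] in
/-- The base on a cross edge. -/
lemma baseX_C {e : E} {i j : X} (he : ends e = s(p i, p j)) : baseX ends h u p ζ e = true :=
  crossForce_C he

omit hl hζ hk in
omit [Fintype E] [DecidableEq E] [Fintype X] [DecidableRel G.Adj] in
/-- The base on an outside edge of a dropped vertex. -/
lemma CrossJunction.baseX_Ext {e : E} {i : X} {x : V} (he : ends e = s(p i, x)) (hxu : x ≠ u)
    (hxp : ∀ j, x ≠ p j) : baseX ends h u p ζ e = false :=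
  crossForce_Ext hj.hne_up he hxu hxp

omit [Fintype X] [DecidableRel G.Adj] in
/-- The realisation on an edge touching an arm of the point. -/
lemma CrossJunction.crossReal_qOf_arm {P : Set V} (hP : P ∈ armsC ends h u ζ)
    (hPp : ∀ i, p i ∉ P) {e : E} (he : e ∈ touches ends P) :
    (if decide (P ⊆ cluster ends ζ h) = true then baseX ends h u p ζ e else !baseX ends h u p ζ e) =
      ζ e := by
  rcases hj.arm_side hl hζ hk hP hPp with hPr | hPb
  · have hc : decide (P ⊆ cluster ends ζ h) = true := by
      simp only [decide_eq_true_eq]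
      exact fun x hx => (hPr hx).1
    rw [if_pos hc, hj.baseX_touch_red hl hζ hk hP hPp hPr he]
  · have hc : ¬ decide (P ⊆ cluster ends ζ h) = true := by
      simp only [decide_eq_true_eq]
      obtain ⟨x, hx⟩ := armsC_nonempty hP
      exact fun hsub => (hPb hx).2 (hsub hx)
    rw [if_neg hc, hj.baseX_touch_blue hl hζ hk hP hPp hPb he, Bool.not_not]

/-- **A core-kind point is the realisation of `qOf`.** -/
theorem CrossJunction.crossReal_qOf :
    crossReal ends u (UX ends h u p (baseX ends h u p ζ)) p G (FX ends h u p (baseX ends h u p ζ))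
      (baseX ends h u p ζ) (qOf ends h u p G ζ) = ζ := by
  have hb := hj.crossBase_of_coreKind hl hζ hk
  funext e
  by_cases hF : ∃ k, e ∈ touches ends (FX ends h u p (baseX ends h u p ζ) k)
  · obtain ⟨k, hk'⟩ := hF
    rw [hb.crossReal_apply_F hk']
    exact hj.crossReal_qOf_arm hl hζ hk (hj.farArm_baseX hl hζ hk k).1
      (hj.farArm_baseX hl hζ hk k).2.1 hk'
  by_cases hU : ∃ j, e ∈ touches ends (UX ends h u p (baseX ends h u p ζ) j)
  · obtain ⟨j, hj'⟩ := hU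
    rw [hb.crossReal_apply_U hj']
    exact hj.crossReal_qOf_arm hl hζ hk (hj.uArm_baseX hl hζ hk j).1
      (hj.uArm_baseX hl hζ hk j).2.1 hj'
  by_cases hUP : ∃ i, e ∈ clsUPX ends u p i
  · obtain ⟨i, hi⟩ := hUP
    have he : ends e = s(u, p i) := hi
    rw [hb.crossReal_apply_UP hi, baseX_UP he]
    have hq : (qOf ends h u p G ζ).2.2.1 i = decide (p i ∈ cluster ends ζ u) := rfl
    rw [hq]
    rcases hj.p_side i with hs | hs
    · have hc : decide (p i ∈ cluster ends ζ u) = true :=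
        decide_eq_true (hj.p_mem_cluster_u_of_redExt hl hζ hk hs)
      rw [if_pos hc, hj.up_red_of_redExt hl hζ hk hs he]
    · have hc : ¬ decide (p i ∈ cluster ends ζ u) = true := by
        simp only [decide_eq_true_eq]
        exact hj.p_notMem_cluster_u_of_blueExt hl hζ hk hs
      rw [if_neg hc, hj.up_blue_of_blueExt hl hζ hk hs he]
      rfl
  by_cases hC : ∃ s, e ∈ clsCX ends p G s
  · obtain ⟨s, hs⟩ := hC
    obtain ⟨i, j, hsij, he⟩ := hs
    rw [hb.crossReal_apply_C ⟨i, j, hsij, he⟩, baseX_C he]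
    -- the cross edge of the pair is unique
    have huniq : ∀ e' ∈ clsCX ends p G s, e' = e := by
      rintro e' ⟨i', j', hsij', he'⟩
      rw [hsij, Sym2.eq_iff] at hsij'
      rcases hsij' with ⟨rfl, rfl⟩ | ⟨rfl, rfl⟩
      · exact hj.hcross_simple i j e' e he' he
      · exact hj.hcross_simple j i e' e he' (ends_swap he)
    have hq : (qOf ends h u p G ζ).2.2.2.1 s = decide (∃ e ∈ clsCX ends p G s, ζ e = true) := rfl
    rw [hq]
    by_cases hce : ζ e = true
    · have hc : decide (∃ e ∈ clsCX ends p G s, ζ e = true) = true :=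
        decide_eq_true ⟨e, ⟨i, j, hsij, he⟩, hce⟩
      rw [if_pos hc, hce]
    · have hc : ¬ decide (∃ e ∈ clsCX ends p G s, ζ e = true) = true := by
        simp only [decide_eq_true_eq, not_exists, not_and]
        intro e' he' hc'
        rw [huniq e' he'] at hc'
        exact hce hc'
      rw [if_neg hc]
      cases hc' : ζ e with
      | false => rfl
      | true => exact absurd hc' hce
  by_cases hX : ∃ i, e ∈ clsExtX ends u p i
  · obtain ⟨i, hi⟩ := hX
    obtain ⟨x, hex, hxu, hxp⟩ := hi
    rw [hb.crossReal_apply_Ext ⟨x, hex, hxu, hxp⟩, hj.baseX_Ext hex hxu hxp]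
    have hq : (qOf ends h u p G ζ).2.2.2.2 i = decide (p i ∈ cluster ends ζ u) := rfl
    rw [hq]
    rcases hj.p_side i with hs | hs
    · have hc : decide (p i ∈ cluster ends ζ u) = true :=
        decide_eq_true (hj.p_mem_cluster_u_of_redExt hl hζ hk hs)
      rw [if_pos hc, hj.ext_blue_of_redExt hζ hk hs hex hxu hxp]
    · have hc : ¬ decide (p i ∈ cluster ends ζ u) = true := by
        simp only [decide_eq_true_eq]
        exact hj.p_notMem_cluster_u_of_blueExt hl hζ hk hs
      rw [if_neg hc, hj.ext_red_of_blueExt hζ hk hs hex hxu hxp]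
      rfl
  · simp only [not_exists] at hF hU hUP hC hX
    rw [CrossBase.crossReal_apply_none hF hU hUP hC hX]
    -- an edge in no class has no end at a dropped vertex and does not touch the blue side
    have hnp : ∀ i, p i ∉ ends e := by
      intro i hi
      obtain ⟨x, hx⟩ := Sym2.mem_iff_exists.1 hi
      rcases hj.p_nbr hx with rfl | ⟨j, rfl, hadj⟩ | hxU
      · exact hUP i (ends_swap hx)
      · exact hC ⟨s(i, j), G.mem_edgeSet.2 hadj⟩ ⟨i, j, rfl, hx⟩
      · exact hX i ⟨x, hx, fun h' => hxU (h' ▸ hj.huU), fun j h' => hxU (h' ▸ hj.hpU j)⟩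
    rw [baseX_apply_not_p hnp, flip_apply_of_notMem]
    rintro ⟨x, hx, y, hxy⟩
    -- `x` is on the blue side: in an arm, or `u`
    have hxH : x ∈ extHull ends ζ h u := Or.inl (Or.inr hx.1)
    have hxh : x ≠ h := fun h' => hx.2 (h' ▸ mem_cluster_self _ _ _)
    by_cases hxu : x = u
    · subst hxu
      rcases hb.u_edges e y hxy with ⟨j, hy⟩ | ⟨i, rfl⟩
      · exact hU j ⟨y, hy, x, ends_swap hxy⟩
      · exact hUP i hxy
    · have hxp : ∀ i, x ≠ p i := fun i h' => hnp i (by rw [hxy, h']; exact Sym2.mem_mk_left _ _)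
      obtain ⟨P, hP, hPp, hxP⟩ := hj.exists_arm_of_mem_extHull hζ hk hxH hxh hxu hxp
      rcases mem_armsAllX_iff.1 (hj.mem_armsAllX_of_arm hl hζ hk hP hPp hxP) with ⟨j, hj'⟩ | ⟨k, hk'⟩
      · exact hU j ⟨x, hj', y, hxy⟩
      · exact hF k ⟨x, hk', y, hxy⟩

omit [Fintype X] [DecidableRel G.Adj] in
/-- The point `qOf` has no red-side leak. -/
theorem CrossJunction.not_leakRX_qOf (hG : G.Connected) : ¬ LeakRX G (qOf ends h u p G ζ) := by
  rintro ⟨-, i, hatt, hi⟩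
  rcases hj.p_same_side hl hζ hk hG with hs | hs
  · -- red side: the outside bits are `true`
    simp only [qOf, decide_eq_false_iff_not] at hi
    exact hi (hj.p_mem_cluster_u_of_redExt hl hζ hk (hs i))
  · -- blue side: nothing is attached
    exact not_attE_of_uP_false G (fun i => by
      simp only [qOf, decide_eq_false_iff_not]
      exact hj.p_notMem_cluster_u_of_blueExt hl hζ hk (hs i)) i hatt

omit [Fintype X] [DecidableRel G.Adj] in
/-- The point `qOf` has no blue-side leak. -/
theorem CrossJunction.not_leakBX_qOf (hG : G.Connected) : ¬ LeakBX G (qOf ends h u p G ζ) := by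
  rintro ⟨-, i, hatt, hi⟩
  rcases hj.p_same_side hl hζ hk hG with hs | hs
  · -- red side: nothing is attached at the flipped point
    exact not_attE_of_uP_false G (fun i => by
      simp only [flipXG, FibKE.flip, qOf, Bool.not_eq_false', decide_eq_true_eq]
      exact hj.p_mem_cluster_u_of_redExt hl hζ hk (hs i)) i hatt
  · -- blue side: the flipped outside bits are `true`
    simp only [flipXG, FibKE.flip, qOf, Bool.not_eq_false', decide_eq_true_eq] at hi
    exact hj.p_notMem_cluster_u_of_blueExt hl hζ hk (hs i) hi

/-- **A core-kind class point lies in the block of its base.** -/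
theorem CrossJunction.mem_blockX_baseX (hG : G.Connected) :
    ζ ∈ blockX ends h u p G (baseX ends h u p ζ) := by
  simp only [blockX, blockCX, Finset.mem_image, Finset.mem_filter, Finset.mem_univ, true_and]
  exact ⟨qOf ends h u p G ζ, ⟨hj.not_leakRX_qOf hl hζ hk hG, hj.not_leakBX_qOf hl hζ hk hG⟩,
    hj.crossReal_qOf hl hζ hk⟩

end Real

end CrossArm

end Summit.Ventures.PercRepro2
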